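import Summits.AtomisticToContinuum.HydrodynamicLimit.Theses.LindebergRandomFuture
import Summits.AtomisticToContinuum.HydrodynamicLimit.Theorems.LambertianContactSwapLambertianEulerOfHearts
import Summits.AtomisticToContinuum.HydrodynamicLimit.Theses.LambertianContactSwap
import Summits.AtomisticToContinuum.HydrodynamicLimit.Theorems.LambertianContactSwapLambertianEulerArchimedes
import Summits.AtomisticToContinuum.HydrodynamicLimit.Theorems.LambertianContactSwapLambertianEulerLambertLaw
import Summits.AtomisticToContinuum.HydrodynamicLimit.Theorems.LambertianContactSwapLambertianEulerPovzner
import Summits.AtomisticToContinuum.HydrodynamicLimit.Theorems.LambertianContactSwapLambertianEulerPairPovzner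
import Summits.AtomisticToContinuum.HydrodynamicLimit.Theorems.LambertianContactSwapLambertianEulerContactIsotropy
import Summits.AtomisticToContinuum.HydrodynamicLimit.Theorems.LambertianContactSwapLambertianEulerMomentLedgerChain
import Summits.AtomisticToContinuum.HydrodynamicLimit.Theorems.LambertianContactSwapLambertianEulerGibbsInvariance
import Summits.AtomisticToContinuum.HydrodynamicLimit.Theorems.LambertianContactSwapLambertianEulerEntropyToHydro
import Summits.AtomisticToContinuum.HydrodynamicLimit.Theorems.LambertianContactSwapLambertianEulerWindow
import Summits.AtomisticToContinuum.HydrodynamicLimit.Theorems.LambertianContactSwapLambertianEulerMarkov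
import Summits.AtomisticToContinuum.HydrodynamicLimit.Theorems.LambertianContactSwapLambertianEulerIterate
import Summits.AtomisticToContinuum.HydrodynamicLimit.Theorems.LambertianContactSwapLambertianEulerDock
import Summits.AtomisticToContinuum.HydrodynamicLimit.Theorems.LambertianContactSwapLambertianEulerKlLedger
import Summits.AtomisticToContinuum.HydrodynamicLimit.Theorems.LambertianContactSwapLambertianEulerLawSemigroup
import Summits.AtomisticToContinuum.HydrodynamicLimit.Theorems.LambertianContactSwapLambertianEulerDockRf
import Summits.AtomisticToContinuum.HydrodynamicLimit.Theorems.LambertianContactSwapLambertianEulerLambertDirMean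
import Summits.AtomisticToContinuum.HydrodynamicLimit.Theorems.LambertianContactSwapLambertianEulerPairMeanSq
import Summits.AtomisticToContinuum.HydrodynamicLimit.Theorems.LambertianContactSwapLambertianEulerPathwiseProduction
import Summits.AtomisticToContinuum.HydrodynamicLimit.Theorems.LambertianContactSwapLambertianEulerWindowLedger
import Summits.AtomisticToContinuum.HydrodynamicLimit.Theorems.LambertianContactSwapLambertianEulerCollisionCompensator
import Summits.AtomisticToContinuum.HydrodynamicLimit.Theorems.LambertianContactSwapLambertianEulerCompensatedJump
import Summits.AtomisticToContinuum.HydrodynamicLimit.Theorems.LambertianContactSwapLambertianEulerAprioriEntropyBound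
import Summits.AtomisticToContinuum.HydrodynamicLimit.Theorems.LambertianContactSwapLambertianEulerCollisionIntensity
import Summits.AtomisticToContinuum.HydrodynamicLimit.Theorems.LambertianContactSwapLambertianEulerTwoTimeLaw
import Summits.AtomisticToContinuum.HydrodynamicLimit.Theorems.LambertianContactSwapLambertianEulerCollisionBudget
import Summits.AtomisticToContinuum.HydrodynamicLimit.Theorems.LambertianContactSwapLambertianEulerExpectedWindowProductionTools
import Summits.AtomisticToContinuum.HydrodynamicLimit.Theorems.LambertianContactSwapLambertianEulerExpectedWindowProduction
import Summits.AtomisticToContinuum.HydrodynamicLimit.Theorems.LambertianContactSwapLambertianEulerProductionSplit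
import Summits.AtomisticToContinuum.HydrodynamicLimit.Theorems.TwoClocksClampedEntropyClockTimeZeroReference
import Summits.AtomisticToContinuum.HydrodynamicLimit.Theorems.TwoClocksClampedEntropyClockDiscreteEntropyGronwall
import Summits.AtomisticToContinuum.HydrodynamicLimit.Theorems.TwoClocksClampedEntropyClockKlDivLawAtLocalGibbsNeTop
import Literature.MathematicalPhysics.KineticTheory.LambertianRedrawNondegenerate
import Literature.MathematicalPhysics.KineticTheory.Hilbert6Wave0Proofs
import Literature.MathematicalPhysics.KineticTheory.HardSphereEulerLLN
import Literature.Barriers.AtomisticToContinuum.HighMomentumCutoff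
import Literature.Analysis.FluidPDE.HardSphereAlexander
import HarnessLib
import Summits.AtomisticToContinuum.HydrodynamicLimit.Theorems.CollisionActivityTails.Negative.EquilibriumReduction

/-! TTRL-lite variant V4534 of stmt-AtomisticToContinuum-11854 -/

namespace Summit.AtomisticToContinuum.HydrodynamicLimit.Theorems

open scoped BigOperators Topology ENNReal InnerProductSpace
open MeasureTheory ProbabilityTheory Filter Set InformationTheory
open Literature.MathematicalPhysics.KineticTheory
open Literature.Analysis.FluidPDE Literature.Analysis.FluidPDE.Alexander
open Summit.AtomisticToContinuum.HydrodynamicLimit.Theses.LambertianContactSwap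
open Summit.AtomisticToContinuum.HydrodynamicLimit.Theorems.ClampedCurrentsDockPathwise (gSum DgSum)

/-- **Variant V4534 of `stub_diluteSelfConsistency` (hypothesis `0 < η` dropped) is FALSE.**
Witness: `η = 0` and the constant profiles `a₀ ≡ 1`, `θ₀ ≡ 1`, `u₀ ≡ 0`. For every `σ₀ > 0` pick
`0 < σ < min σ₀ σ₁ (1/2)`: the constant state `(r, 0, 1)` (with `r > 0` the constant LLN density of
`CollisionActivityTailsEquilibrium.constantProfileLLN_holds`) is a classical hard-sphere-Euler solution on
`[0, 1)` (`DenseExcursionUntied.isHardSphereEulerSolution_const`), hard-sphere flow families exist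
(`CollisionActivityTailsEquilibrium.flows_nonempty`, Alexander), and the `t = 0` LLN tie holds; but the
conclusion would give `r σ³ < 0`, contradicting `r, σ > 0`. So the positivity of `η` is load-bearing only
in the degenerate sense: the statement with `η ≤ 0` has satisfiable hypotheses and an unsatisfiable
conclusion. -/
theorem stub_diluteSelfConsistency_var4534_false :
    ¬ (∀ (η : ℝ) (a₀ θ₀ : T3 → ℝ) (u₀ : T3 → V3), Continuous a₀ → Continuous θ₀ → Continuous u₀ → (∀ x, 0 < a₀ x) → (∀ x, 0 < θ₀ x) → ∃ σ₀ : ℝ, 0 < σ₀ ∧ ∀ σ : ℝ, 0 < σ → σ < σ₀ → ∀ (T : ℝ) (ρ θ : ℝ → T3 → ℝ) (u : ℝ → T3 → V3), IsHardSphereEulerSolution σ T ρ u θ → ∀ Φ : (N : ℕ) → HardSphereFlow (Torus.geometry (Fin 3)) (hsDiameter σ N) (N + 1), TendstoHydroFieldsAt (fun N => localGibbsLaw σ a₀ u₀ θ₀ N (Φ N)) Φ ρ u θ 0 → ∀ t ∈ Set.Ico 0 T, ∀ x, ρ t x * σ ^ 3 < η) := by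
  intro H
  obtain ⟨σ₀, hσ₀, H'⟩ := H 0 (fun _ => 1) (fun _ => 1) (fun _ => 0) continuous_const continuous_const
    continuous_const (fun _ => one_pos) (fun _ => one_pos)
  obtain ⟨σ₁, hσ₁, hl⟩ :=
    CollisionActivityTailsEquilibrium.constantProfileLLN_holds 1 1 0 one_pos one_pos
  have hm : 0 < min σ₀ (min σ₁ (1 / 2)) := lt_min hσ₀ (lt_min hσ₁ (by norm_num))
  set σ : ℝ := min σ₀ (min σ₁ (1 / 2)) / 2 with hσdef
  have hσ : 0 < σ := by positivity
  have hσσ₀ : σ < σ₀ := by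
    have := min_le_left σ₀ (min σ₁ (1 / 2))
    rw [hσdef]; linarith
  have hσσ₁ : σ < σ₁ := by
    have := (min_le_right σ₀ (min σ₁ (1 / 2))).trans (min_le_left σ₁ (1 / 2 : ℝ))
    rw [hσdef]; linarith
  have hσ2 : σ < 1 / 2 := by
    have := (min_le_right σ₀ (min σ₁ (1 / 2))).trans (min_le_right σ₁ (1 / 2 : ℝ))
    rw [hσdef]; linarith
  obtain ⟨r, hr, hlln⟩ := hl σ hσ hσσ₁
  obtain ⟨Φ⟩ := CollisionActivityTailsEquilibrium.flows_nonempty hσ hσ2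
  have key := H' σ hσ hσσ₀ 1 (fun _ _ => r) (fun _ _ => 1) (fun _ _ => 0)
    (DenseExcursionUntied.isHardSphereEulerSolution_const σ 1 0 hr one_pos) Φ (hlln Φ) 0
    ⟨le_rfl, one_pos⟩ 0
  have hpos : 0 < r * σ ^ 3 := by positivity
  linarith

end Summit.AtomisticToContinuum.HydrodynamicLimit.Theorems
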